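import Summits.Ventures.HSemireg.Mod4CarrierTopForm

/-!
# Venture HSemireg — the Weil vectors `w₊`, `w₋` as the TOP LINES of the two blocks: intrinsic form of `wUp`, `wLow`

HONEST FRAMING. Part of the Lean index of the computation cell `pub-hsemireg` (seat w3-mod4-1 gen 8, W3 SPECIAL FIBRES,
MOD4-OFFSPLIT §1 / §12: the dictionary residual of THEOREM R_f on p4's carrier). Finite-dimensional exterior / linear algebra
over a field ONLY: no variety, no cohomology theory, no semiregularity map is constructed here; nothing here says that
HC / HC_CM / HC_AV holds; no Literature fact is declared or used.

WHAT IS PROVED. On the carrier, `w₊ = wUp bV p = ℓ_p ∧ ⋯ ∧ ℓ_{N-1} ∧ m_{p-1} ∧ ⋯ ∧ m_0` and `w₋ = wLow bV p` are GIVEN as words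
in an adapted basis. Intrinsically the Weil vectors of a Weil-type structure are «`det H¹_±`»: generators of the images in `ΛV`
of the top exterior powers of the two eigenblocks `P`, `Q ⊆ V`. Here, with NO definition introduced: the BLOCK POWERS
`(⋀^k P).map (ΛP → ΛV)` (image of `⋀^k P` in `ΛV`; multiplicative in `k`, contains `ι(P)` in degree one) and the TOP LINE = the
block power in degree `dim P`, of dimension `≤ 1`
(`finrank_topLine_le_one`, from Mathlib's `exteriorPower.finrank_eq`); for a basis `bV` whose block
`{ℓ_c (c ≥ p), m_c (c < p)}` lies in `P` with `dim P = N`, `wUp bV p ∈` top line of `P` (`wUp_mem_topLine`), hence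
**top line of `P` `= K ∙ wUp bV p`** (`topLine_eq_span_wUp`, using `LMprod_ne_zero` / `wUp_mul_wLow` for `wUp ≠ 0`) and every
`w` of the top line is `a • wUp bV p` (`exists_eq_smul_wUp`); the mirror statements for `Q` and `wLow`. So in the carrier theorems
the Weil part `a • w₊ + b • w₋` may be replaced by «`w₊' + w₋'` with `w₊'`, `w₋'` non-zero members of the top lines of `P`, `Q`» —
no word in a basis. Everything PROVED, 0 sorry; NO definition is introduced (the block powers are written out as Mathlib terms).
References: [BourbakiAlgebre1a3] Ch. III §7 no. 2 (functoriality of `⋀`), §7 no. 8 (`⋀^{top}` of a free module is a line).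
-/

noncomputable section

open ExteriorAlgebra (ι)
open Module

namespace Summit.Ventures.HSemireg.WeilFrame

open Summit.Ventures.HSemireg.WedgeBridge Summit.Ventures.HSemireg.WeilCarrier Summit.Ventures.HSemireg.Mod4Carrier

variable {K : Type*} [Field K] {V : Type*} [AddCommGroup V] [Module K V]

/-! ### 1. The block powers `(⋀^k P).map (ΛP → ΛV)` = image of `⋀^k P` in `Λ V`, and the top line (degree `dim P`) -/

/-- `1` lies in the degree-`0` block power. -/
lemma one_mem_blockPow (P : Submodule K V) : (1 : ExteriorAlgebra K V) ∈ ((⋀[K]^0 ↥P).map (ExteriorAlgebra.map P.subtype).toLinearMap) :=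
  ⟨1, SetLike.one_mem_graded _, by rw [AlgHom.toLinearMap_apply, map_one]⟩

/-- `ι x` lies in the degree-`1` block power for `x ∈ P`. -/
lemma ι_mem_blockPow {P : Submodule K V} {x : V} (hx : x ∈ P) : ι K x ∈ ((⋀[K]^1 ↥P).map (ExteriorAlgebra.map P.subtype).toLinearMap) := by
  refine ⟨ι K (⟨x, hx⟩ : ↥P), ?_, ?_⟩
  · change ι K (⟨x, hx⟩ : ↥P) ∈ LinearMap.range (ι K : ↥P →ₗ[K] ExteriorAlgebra K ↥P) ^ 1
    rw [pow_one]; exact LinearMap.mem_range_self _ _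
  · rw [AlgHom.toLinearMap_apply, ExteriorAlgebra.map_apply_ι, Submodule.subtype_apply]

/-- block powers multiply: degree `i` times degree `j` lands in degree `i + j`. [cite: BourbakiAlgebre1a3, Ch. III §7 no. 2] -/
lemma mul_mem_blockPow {P : Submodule K V} {i j : ℕ} {x y : ExteriorAlgebra K V} (hx : x ∈ ((⋀[K]^i ↥P).map (ExteriorAlgebra.map P.subtype).toLinearMap))
    (hy : y ∈ ((⋀[K]^j ↥P).map (ExteriorAlgebra.map P.subtype).toLinearMap)) :
    x * y ∈ ((⋀[K]^(i + j) ↥P).map (ExteriorAlgebra.map P.subtype).toLinearMap) := by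
  obtain ⟨a, ha, rfl⟩ := hx
  obtain ⟨b, hb, rfl⟩ := hy
  exact ⟨a * b, SetLike.mul_mem_graded ha hb, by rw [AlgHom.toLinearMap_apply, AlgHom.toLinearMap_apply,
    AlgHom.toLinearMap_apply, map_mul]⟩

/-- the factor `if c then ι x else 1` of the carrier recursions lies in the block power of degree `if c then 1 else 0`. -/
lemma ite_mem_blockPow {P : Submodule K V} (c : Prop) [Decidable c] {x : V} (hx : c → x ∈ P) :
    (if c then ι K x else 1) ∈ ((⋀[K]^(if c then 1 else 0) ↥P).map (ExteriorAlgebra.map P.subtype).toLinearMap) := by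
  by_cases h : c
  · rw [if_pos h, if_pos h]; exact ι_mem_blockPow (hx h)
  · rw [if_neg h, if_neg h]; exact one_mem_blockPow P

/-- **the top line is a line:** the block power of degree `dim P` has dimension `≤ 1` (`⋀^{dim P} P` has dimension `C(dim P, dim P) = 1`).
[cite: BourbakiAlgebre1a3, Ch. III §7 no. 8] -/
theorem finrank_topLine_le_one [FiniteDimensional K V] (P : Submodule K V) :
    finrank K ↥((⋀[K]^(finrank K ↥P) ↥P).map (ExteriorAlgebra.map P.subtype).toLinearMap) ≤ 1 := by
  have h := Submodule.finrank_map_le (ExteriorAlgebra.map P.subtype).toLinearMap (⋀[K]^(finrank K ↥P) ↥P)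
  rw [exteriorPower.finrank_eq, Nat.choose_self] at h
  exact h

/-- a line containing a non-zero vector is spanned by it. -/
lemma topLine_eq_span_of_mem [FiniteDimensional K V] {P : Submodule K V} {w : ExteriorAlgebra K V}
    (hw : w ∈ ((⋀[K]^(finrank K ↥P) ↥P).map (ExteriorAlgebra.map P.subtype).toLinearMap)) (hw0 : w ≠ 0) :
    ((⋀[K]^(finrank K ↥P) ↥P).map (ExteriorAlgebra.map P.subtype).toLinearMap) = K ∙ w := by
  refine (Submodule.eq_of_le_of_finrank_le ((Submodule.span_singleton_le_iff_mem w _).mpr hw) ?_).symm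
  rw [finrank_span_singleton hw0]
  exact finrank_topLine_le_one P

/-! ### 2. The carrier's block words lie in the block powers -/

section Carrier

variable {N : ℕ} (bV : Basis (Fin (N + N)) K V)

/-- `ℓN bV k ∈ P` for `p ≤ k < N` from the block hypothesis «`ℓ_c ∈ P` for `c ≥ p`». -/
lemma ℓN_mem_of_le {P : Submodule K V} {p : ℕ} (hℓ : ∀ c : Fin N, p ≤ c.val → ℓ bV c ∈ P) {k : ℕ} (hk : k < N)
    (hpk : p ≤ k) : ℓN bV k ∈ P := by
  rw [ℓN, dif_pos hk]; exact hℓ ⟨k, hk⟩ hpk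

/-- `ℓN bV k ∈ Q` for `k < p`, `k < N` from the block hypothesis «`ℓ_c ∈ Q` for `c < p`». -/
lemma ℓN_mem_of_lt {Q : Submodule K V} {p : ℕ} (hℓ : ∀ c : Fin N, c.val < p → ℓ bV c ∈ Q) {k : ℕ} (hk : k < N)
    (hkp : k < p) : ℓN bV k ∈ Q := by
  rw [ℓN, dif_pos hk]; exact hℓ ⟨k, hk⟩ hkp

/-- `mN bV k ∈ Q` for `p ≤ k < N` from the block hypothesis «`m_c ∈ Q` for `c ≥ p`». -/
lemma mN_mem_of_le {Q : Submodule K V} {p : ℕ} (hm : ∀ c : Fin N, p ≤ c.val → m bV c ∈ Q) {k : ℕ} (hk : k < N)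
    (hpk : p ≤ k) : mN bV k ∈ Q := by
  rw [mN, dif_pos hk]; exact hm ⟨k, hk⟩ hpk

/-- `mN bV k ∈ P` for `k < p`, `k < N` from the block hypothesis «`m_c ∈ P` for `c < p`». -/
lemma mN_mem_of_lt {P : Submodule K V} {p : ℕ} (hm : ∀ c : Fin N, c.val < p → m bV c ∈ P) {k : ℕ} (hk : k < N)
    (hkp : k < p) : mN bV k ∈ P := by
  rw [mN, dif_pos hk]; exact hm ⟨k, hk⟩ hkp

/-- `ellprodFrom p k = ℓ_p ∧ ⋯ ∧ ℓ_{k-1}` lies in the block power of `P` of degree `k - p` when `ℓ_c ∈ P` for `c ≥ p`. -/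
lemma ellprodFrom_mem {P : Submodule K V} {p : ℕ} (hℓ : ∀ c : Fin N, p ≤ c.val → ℓ bV c ∈ P) :
    ∀ k : ℕ, k ≤ N → ellprodFrom bV p k ∈ ((⋀[K]^(k - p) ↥P).map (ExteriorAlgebra.map P.subtype).toLinearMap)
  | 0, _ => by rw [ellprodFrom, Nat.zero_sub]; exact one_mem_blockPow P
  | k + 1, hk => by
    have h := mul_mem_blockPow (ellprodFrom_mem hℓ k (by omega))
      (ite_mem_blockPow (p ≤ k) (x := ℓN bV k) fun hpk => ℓN_mem_of_le bV hℓ (by omega) hpk)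
    have he : k - p + (if p ≤ k then 1 else 0) = k + 1 - p := by split_ifs <;> omega
    rw [ellprodFrom, ← he]; exact h

/-- `vac k = m_{k-1} ∧ ⋯ ∧ m_0` lies in the block power of `P` of degree `k` when `m_c ∈ P` for `c < p` and `k ≤ p`. -/
lemma vac_mem {P : Submodule K V} {p : ℕ} (hm : ∀ c : Fin N, c.val < p → m bV c ∈ P) :
    ∀ k : ℕ, k ≤ p → k ≤ N → vac bV k ∈ ((⋀[K]^k ↥P).map (ExteriorAlgebra.map P.subtype).toLinearMap)
  | 0, _, _ => one_mem_blockPow P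
  | k + 1, hkp, hkN => by
    have h := mul_mem_blockPow (ι_mem_blockPow (mN_mem_of_lt bV hm (k := k) (by omega) (by omega)))
      (vac_mem hm k (by omega) (by omega))
    rw [vac, add_comm k 1]; exact h

/-- `ellprod k = ℓ_0 ∧ ⋯ ∧ ℓ_{k-1}` lies in the block power of `Q` of degree `k` when `ℓ_c ∈ Q` for `c < p` and `k ≤ p`. -/
lemma ellprod_mem {Q : Submodule K V} {p : ℕ} (hℓ : ∀ c : Fin N, c.val < p → ℓ bV c ∈ Q) :
    ∀ k : ℕ, k ≤ p → k ≤ N → ellprod bV k ∈ ((⋀[K]^k ↥Q).map (ExteriorAlgebra.map Q.subtype).toLinearMap)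
  | 0, _, _ => one_mem_blockPow Q
  | k + 1, hkp, hkN => by
    have h := mul_mem_blockPow (ellprod_mem hℓ k (by omega) (by omega))
      (ι_mem_blockPow (ℓN_mem_of_lt bV hℓ (k := k) (by omega) (by omega)))
    rw [ellprod]; exact h

/-- `vacFrom p k` lies in the block power of `Q` of degree `k - p` when `m_c ∈ Q` for `c ≥ p`. -/
lemma vacFrom_mem {Q : Submodule K V} {p : ℕ} (hm : ∀ c : Fin N, p ≤ c.val → m bV c ∈ Q) :
    ∀ k : ℕ, k ≤ N → vacFrom bV p k ∈ ((⋀[K]^(k - p) ↥Q).map (ExteriorAlgebra.map Q.subtype).toLinearMap)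
  | 0, _ => by rw [vacFrom, Nat.zero_sub]; exact one_mem_blockPow Q
  | k + 1, hk => by
    have h := mul_mem_blockPow (ite_mem_blockPow (p ≤ k) (x := mN bV k) fun hpk => mN_mem_of_le bV hm (by omega) hpk)
      (vacFrom_mem hm k (by omega))
    have he : (if p ≤ k then 1 else 0) + (k - p) = k + 1 - p := by split_ifs <;> omega
    rw [vacFrom, ← he]; exact h

/-- **`w₊` lies in the top line of its block:** if `ℓ_c ∈ P` (`c ≥ p`), `m_c ∈ P` (`c < p`), `p ≤ N` and `dim P = N`, then
`wUp bV p` lies in the top line of `P`. [cite: BourbakiAlgebre1a3, Ch. III §7 no. 8] -/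
theorem wUp_mem_topLine {P : Submodule K V} {p : ℕ} (hp : p ≤ N) (hP : finrank K ↥P = N)
    (hℓ : ∀ c : Fin N, p ≤ c.val → ℓ bV c ∈ P) (hm : ∀ c : Fin N, c.val < p → m bV c ∈ P) :
    wUp bV p ∈ ((⋀[K]^(finrank K ↥P) ↥P).map (ExteriorAlgebra.map P.subtype).toLinearMap) := by
  have h := mul_mem_blockPow (ellprodFrom_mem bV hℓ N le_rfl) (vac_mem bV hm p le_rfl hp)
  have he : N - p + p = N := by omega
  rw [he] at h
  rw [hP, wUp]
  exact h

/-- **`w₋` lies in the top line of its block:** if `ℓ_c ∈ Q` (`c < p`), `m_c ∈ Q` (`c ≥ p`), `p ≤ N` and `dim Q = N`, then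
`wLow bV p` lies in the top line of `Q`. [cite: BourbakiAlgebre1a3, Ch. III §7 no. 8] -/
theorem wLow_mem_topLine {Q : Submodule K V} {p : ℕ} (hp : p ≤ N) (hQ : finrank K ↥Q = N)
    (hℓ : ∀ c : Fin N, c.val < p → ℓ bV c ∈ Q) (hm : ∀ c : Fin N, p ≤ c.val → m bV c ∈ Q) :
    wLow bV p ∈ ((⋀[K]^(finrank K ↥Q) ↥Q).map (ExteriorAlgebra.map Q.subtype).toLinearMap) := by
  have h := mul_mem_blockPow (ellprod_mem bV hℓ p le_rfl hp) (vacFrom_mem bV hm N le_rfl)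
  have he : p + (N - p) = N := by omega
  rw [he] at h
  rw [hQ, wLow]
  exact h

/-- `wUp bV p ≠ 0` (its product with `wLow bV p` is `± Θ^N/N! ≠ 0`). -/
theorem wUp_ne_zero {p : ℕ} (hp : p ≤ N) : wUp bV p ≠ 0 := by
  intro h
  have h' := wUp_mul_wLow bV hp
  rw [h, zero_mul] at h'
  exact LMprod_ne_zero bV ((smul_eq_zero.mp h'.symm).resolve_left (pow_ne_zero _ (neg_ne_zero.mpr one_ne_zero)))

/-- `wLow bV p ≠ 0`. -/
theorem wLow_ne_zero {p : ℕ} (hp : p ≤ N) : wLow bV p ≠ 0 := by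
  intro h
  have h' := wUp_mul_wLow bV hp
  rw [h, mul_zero] at h'
  exact LMprod_ne_zero bV ((smul_eq_zero.mp h'.symm).resolve_left (pow_ne_zero _ (neg_ne_zero.mpr one_ne_zero)))

/-- **the top line of the `w₊`-block IS `K · w₊`.** [cite: BourbakiAlgebre1a3, Ch. III §7 no. 8] -/
theorem topLine_eq_span_wUp [FiniteDimensional K V] {P : Submodule K V} {p : ℕ} (hp : p ≤ N)
    (hP : finrank K ↥P = N) (hℓ : ∀ c : Fin N, p ≤ c.val → ℓ bV c ∈ P) (hm : ∀ c : Fin N, c.val < p → m bV c ∈ P) :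
    ((⋀[K]^(finrank K ↥P) ↥P).map (ExteriorAlgebra.map P.subtype).toLinearMap) = K ∙ wUp bV p :=
  topLine_eq_span_of_mem (wUp_mem_topLine bV hp hP hℓ hm) (wUp_ne_zero bV hp)

/-- **the top line of the `w₋`-block IS `K · w₋`.** [cite: BourbakiAlgebre1a3, Ch. III §7 no. 8] -/
theorem topLine_eq_span_wLow [FiniteDimensional K V] {Q : Submodule K V} {p : ℕ} (hp : p ≤ N)
    (hQ : finrank K ↥Q = N) (hℓ : ∀ c : Fin N, c.val < p → ℓ bV c ∈ Q) (hm : ∀ c : Fin N, p ≤ c.val → m bV c ∈ Q) :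
    ((⋀[K]^(finrank K ↥Q) ↥Q).map (ExteriorAlgebra.map Q.subtype).toLinearMap) = K ∙ wLow bV p :=
  topLine_eq_span_of_mem (wLow_mem_topLine bV hp hQ hℓ hm) (wLow_ne_zero bV hp)

/-- every vector of the top line of the `w₊`-block is a multiple of `w₊`; a non-zero one, a non-zero multiple. -/
theorem exists_eq_smul_wUp [FiniteDimensional K V] {P : Submodule K V} {p : ℕ} (hp : p ≤ N)
    (hP : finrank K ↥P = N) (hℓ : ∀ c : Fin N, p ≤ c.val → ℓ bV c ∈ P) (hm : ∀ c : Fin N, c.val < p → m bV c ∈ P)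
    {w : ExteriorAlgebra K V} (hw : w ∈ ((⋀[K]^(finrank K ↥P) ↥P).map (ExteriorAlgebra.map P.subtype).toLinearMap)) (hw0 : w ≠ 0) :
    ∃ a : K, a ≠ 0 ∧ w = a • wUp bV p := by
  rw [topLine_eq_span_wUp bV hp hP hℓ hm, Submodule.mem_span_singleton] at hw
  obtain ⟨a, rfl⟩ := hw
  exact ⟨a, fun ha => hw0 (by rw [ha, zero_smul]), rfl⟩

/-- every vector of the top line of the `w₋`-block is a multiple of `w₋`; a non-zero one, a non-zero multiple. -/
theorem exists_eq_smul_wLow [FiniteDimensional K V] {Q : Submodule K V} {p : ℕ} (hp : p ≤ N)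
    (hQ : finrank K ↥Q = N) (hℓ : ∀ c : Fin N, c.val < p → ℓ bV c ∈ Q) (hm : ∀ c : Fin N, p ≤ c.val → m bV c ∈ Q)
    {w : ExteriorAlgebra K V} (hw : w ∈ ((⋀[K]^(finrank K ↥Q) ↥Q).map (ExteriorAlgebra.map Q.subtype).toLinearMap)) (hw0 : w ≠ 0) :
    ∃ b : K, b ≠ 0 ∧ w = b • wLow bV p := by
  rw [topLine_eq_span_wLow bV hp hQ hℓ hm, Submodule.mem_span_singleton] at hw
  obtain ⟨b, rfl⟩ := hw
  exact ⟨b, fun hb => hw0 (by rw [hb, zero_smul]), rfl⟩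

end Carrier

end Summit.Ventures.HSemireg.WeilFrame

end
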